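import Mathlib
import HarnessLib

/-!
# Catalan rays — half-integer Beta integrals (first analytic brick of the identification node)

Cell `pub-zeta5`, fam-denom (service lane, gen 4).
HONEST FRAMING: systematic search; no irrationality claim unless certified.  Pure calculus; nothing here
concerns the irrationality of `G`.

The one remaining P-side node of the Catalan ray programme is the ANALYTIC identification
`RayIdentification j` (`Denom/CatalanRayIntegralityBridge`): Viola's double integral
`Jsym h j k l m = ∫∫ x^h (1−x)^j y^l (1−y)^k (1−xy)^{−(j+k−m)−1} dx dy / (√x √(1−y))` equals
`rayQ · G + rayPClosed` on the ray.  Its series development (expand `(1−xy)^{−s−1} = Σ_t C(t+s,s)(xy)^t`,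
integrate termwise) meets, in each term, exactly two one-dimensional integrals with a square root in the
measure.  This file evaluates them in closed form (`B(a + 3/2, b + 1)` at half-integer argument, no `Γ`):

* `halfBeta a b = b! · 2^{b+1} / ∏_{i=0}^{b} (2a + 2i + 3)` and its recursion `halfBeta_succ`;
* `integral_pow_mul_pow_mul_sqrt : ∫₀¹ x^a (1−x)^b √x dx = halfBeta a b` (induction on `b`: the base case is
  `∫₀¹ x^{a+1/2} dx`, the step is linearity — no integration by parts);
* `integral_pow_mul_pow_mul_sqrt_one_sub : ∫₀¹ x^b (1−x)^a √(1−x) dx = halfBeta a b` (reflection `x ↦ 1−x`);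
* the two shapes that literally occur in `Jsym`'s integrand, as set integrals over `Ioo 0 1`:
  `setIntegral_pow_mul_pow_div_sqrt : ∫_{(0,1)} x^p (1−x)^q / √x = halfBeta (p−1) q` (`1 ≤ p`) and
  `setIntegral_pow_mul_pow_div_sqrt_one_sub : ∫_{(0,1)} y^p (1−y)^q / √(1−y) = halfBeta (q−1) p` (`1 ≤ q`);
* sanity `halfBeta 0 0 = 2/3` (`= ∫₀¹ √x dx`).
-/

noncomputable section

open MeasureTheory Set

namespace Summit.KontsevichZagierPeriods.Zeta5Search.Denom.CatalanRayBeta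

/-- The half-integer Beta value `B(a + 3/2, b + 1) = b! · 2^{b+1} / ∏_{i=0}^{b} (2a + 2i + 3)`. -/
def halfBeta (a b : ℕ) : ℝ :=
  (b.factorial : ℝ) * 2 ^ (b + 1) / ∏ i ∈ Finset.range (b + 1), (2 * (a : ℝ) + 2 * i + 3)

/-- sanity: `halfBeta 0 0 = 2/3 = ∫₀¹ √x dx`. -/
theorem halfBeta_zero_zero : halfBeta 0 0 = 2 / 3 := by
  unfold halfBeta; norm_num

/-- the denominator of `halfBeta` is positive. -/
theorem halfBeta_den_pos (a b : ℕ) : 0 < ∏ i ∈ Finset.range (b + 1), (2 * (a : ℝ) + 2 * i + 3) :=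
  Finset.prod_pos fun i _ => by positivity

/-- The recursion `halfBeta a (b+1) = halfBeta a b − halfBeta (a+1) b`
(mirrors `(1−x)^{b+1} = (1−x)^b − x(1−x)^b` under the integral). -/
theorem halfBeta_succ (a b : ℕ) : halfBeta a (b + 1) = halfBeta a b - halfBeta (a + 1) b := by
  set f : ℕ → ℝ := fun i => 2 * (a : ℝ) + 2 * i + 3 with hf
  have hfpos : ∀ i, 0 < f i := fun i => by rw [hf]; positivity
  set P : ℝ := ∏ i ∈ Finset.range b, f (i + 1) with hP
  have hPpos : 0 < P := Finset.prod_pos fun i _ => hfpos _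
  have hD0 : ∏ i ∈ Finset.range (b + 1), (2 * (a : ℝ) + 2 * i + 3) = P * f 0 := by
    rw [Finset.prod_range_succ']
  have hD1 : ∏ i ∈ Finset.range (b + 1), (2 * ((a + 1 : ℕ) : ℝ) + 2 * i + 3) = P * f (b + 1) := by
    have h : ∀ i ∈ Finset.range (b + 1), (2 * ((a + 1 : ℕ) : ℝ) + 2 * i + 3) = f (i + 1) := by
      intro i _; simp only [hf]; push_cast; ring
    rw [Finset.prod_congr rfl h, Finset.prod_range_succ]
  have hD2 : ∏ i ∈ Finset.range (b + 1 + 1), (2 * (a : ℝ) + 2 * i + 3) = P * f 0 * f (b + 1) := by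
    rw [Finset.prod_range_succ, hD0]
  unfold halfBeta
  rw [hD0, hD1, hD2]
  have h0 : f 0 = 2 * a + 3 := by simp [hf]
  have h1 : f (b + 1) = 2 * a + 2 * b + 5 := by simp only [hf]; push_cast; ring
  rw [h0, h1, Nat.factorial_succ]
  push_cast
  field_simp
  ring

/-- continuity of the integrand `x^a (1−x)^b √x`. -/
private theorem continuous_integrand (a b : ℕ) : Continuous fun x : ℝ => x ^ a * (1 - x) ^ b * Real.sqrt x :=
  ((continuous_pow a).mul ((continuous_const.sub continuous_id).pow b)).mul Real.continuous_sqrt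

/-- base case: `∫₀¹ x^a √x dx = 1/(a + 3/2) = halfBeta a 0`. -/
theorem integral_pow_mul_sqrt (a : ℕ) : ∫ x in (0 : ℝ)..1, x ^ a * (1 - x) ^ 0 * Real.sqrt x = halfBeta a 0 := by
  have hr : (-1 : ℝ) < (a : ℝ) + 1 / 2 := by
    have : (0 : ℝ) ≤ a := Nat.cast_nonneg a
    linarith
  have heq : EqOn (fun x : ℝ => x ^ a * (1 - x) ^ 0 * Real.sqrt x) (fun x => x ^ ((a : ℝ) + 1 / 2)) (uIcc 0 1) := by
    intro x hx
    rw [uIcc_of_le zero_le_one] at hx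
    have hx0 : 0 ≤ x := hx.1
    simp only [pow_zero, mul_one]
    rw [Real.sqrt_eq_rpow, ← Real.rpow_natCast x a, ← Real.rpow_add' hx0 (by positivity)]
  rw [intervalIntegral.integral_congr heq, integral_rpow (Or.inl hr), Real.one_rpow,
    Real.zero_rpow (by positivity)]
  unfold halfBeta
  rw [Finset.prod_range_one]
  push_cast
  field_simp
  ring

/-- **`∫₀¹ x^a (1−x)^b √x dx = b! · 2^{b+1} / ∏_{i=0}^{b} (2a + 2i + 3)`** (`= B(a + 3/2, b + 1)`). -/
theorem integral_pow_mul_pow_mul_sqrt (a b : ℕ) :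
    ∫ x in (0 : ℝ)..1, x ^ a * (1 - x) ^ b * Real.sqrt x = halfBeta a b := by
  induction b generalizing a with
  | zero => exact integral_pow_mul_sqrt a
  | succ b ih =>
    have hpt : (fun x : ℝ => x ^ a * (1 - x) ^ (b + 1) * Real.sqrt x)
        = fun x => x ^ a * (1 - x) ^ b * Real.sqrt x - x ^ (a + 1) * (1 - x) ^ b * Real.sqrt x := by
      funext x; ring
    rw [hpt, intervalIntegral.integral_sub ((continuous_integrand a b).intervalIntegrable _ _)
      ((continuous_integrand (a + 1) b).intervalIntegrable _ _), ih a, ih (a + 1), halfBeta_succ]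

/-- reflected form: `∫₀¹ x^b (1−x)^a √(1−x) dx = halfBeta a b`. -/
theorem integral_pow_mul_pow_mul_sqrt_one_sub (a b : ℕ) :
    ∫ x in (0 : ℝ)..1, x ^ b * (1 - x) ^ a * Real.sqrt (1 - x) = halfBeta a b := by
  have h1 : (∫ x in (0 : ℝ)..1, x ^ b * (1 - x) ^ a * Real.sqrt (1 - x))
      = ∫ x in (0 : ℝ)..1, (1 - x) ^ a * (1 - (1 - x)) ^ b * Real.sqrt (1 - x) :=
    intervalIntegral.integral_congr fun x _ => by simp only [sub_sub_cancel]; ring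
  have h2 : (∫ x in (0 : ℝ)..1, (1 - x) ^ a * (1 - (1 - x)) ^ b * Real.sqrt (1 - x))
      = ∫ x in (1 : ℝ) - 1..1 - 0, x ^ a * (1 - x) ^ b * Real.sqrt x :=
    intervalIntegral.integral_comp_sub_left (fun x : ℝ => x ^ a * (1 - x) ^ b * Real.sqrt x) 1
  rw [h1, h2, sub_self, sub_zero, integral_pow_mul_pow_mul_sqrt]

/-- **The `x`-integral of `Jsym`'s terms**: `∫_{(0,1)} x^p (1−x)^q / √x dx = halfBeta (p−1) q` for `1 ≤ p`
(`= q! · 2^{q+1} / ∏_{i=0}^{q} (2p + 2i + 1)`). -/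
theorem setIntegral_pow_mul_pow_div_sqrt (p q : ℕ) (hp : 1 ≤ p) :
    ∫ x in Ioo (0 : ℝ) 1, x ^ p * (1 - x) ^ q / Real.sqrt x = halfBeta (p - 1) q := by
  obtain ⟨r, rfl⟩ : ∃ r, p = r + 1 := ⟨p - 1, by omega⟩
  rw [Nat.add_sub_cancel]
  have hcongr : ∫ x in Ioo (0 : ℝ) 1, x ^ (r + 1) * (1 - x) ^ q / Real.sqrt x
      = ∫ x in Ioo (0 : ℝ) 1, x ^ r * (1 - x) ^ q * Real.sqrt x := by
    refine setIntegral_congr_fun measurableSet_Ioo fun x hx => ?_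
    have hx0 : 0 < x := hx.1
    have hs : Real.sqrt x ≠ 0 := (Real.sqrt_pos.mpr hx0).ne'
    have hxx : x ^ (r + 1) = x ^ r * (Real.sqrt x * Real.sqrt x) := by
      rw [Real.mul_self_sqrt hx0.le, pow_succ]
    rw [div_eq_iff hs, hxx]; ring
  rw [hcongr, ← integral_Ioc_eq_integral_Ioo, ← intervalIntegral.integral_of_le zero_le_one,
    integral_pow_mul_pow_mul_sqrt]

/-- **The `y`-integral of `Jsym`'s terms**: `∫_{(0,1)} y^p (1−y)^q / √(1−y) dy = halfBeta (q−1) p` for `1 ≤ q`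
(`= p! · 2^{p+1} / ∏_{i=0}^{p} (2q + 2i + 1)`). -/
theorem setIntegral_pow_mul_pow_div_sqrt_one_sub (p q : ℕ) (hq : 1 ≤ q) :
    ∫ y in Ioo (0 : ℝ) 1, y ^ p * (1 - y) ^ q / Real.sqrt (1 - y) = halfBeta (q - 1) p := by
  obtain ⟨r, rfl⟩ : ∃ r, q = r + 1 := ⟨q - 1, by omega⟩
  rw [Nat.add_sub_cancel]
  have hcongr : ∫ y in Ioo (0 : ℝ) 1, y ^ p * (1 - y) ^ (r + 1) / Real.sqrt (1 - y)
      = ∫ y in Ioo (0 : ℝ) 1, y ^ p * (1 - y) ^ r * Real.sqrt (1 - y) := by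
    refine setIntegral_congr_fun measurableSet_Ioo fun y hy => ?_
    have hy1 : 0 < 1 - y := by linarith [hy.2]
    have hs : Real.sqrt (1 - y) ≠ 0 := (Real.sqrt_pos.mpr hy1).ne'
    have hyy : (1 - y) ^ (r + 1) = (1 - y) ^ r * (Real.sqrt (1 - y) * Real.sqrt (1 - y)) := by
      rw [Real.mul_self_sqrt hy1.le, pow_succ]
    rw [div_eq_iff hs, hyy]; ring
  rw [hcongr, ← integral_Ioc_eq_integral_Ioo, ← intervalIntegral.integral_of_le zero_le_one,
    integral_pow_mul_pow_mul_sqrt_one_sub]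

end Summit.KontsevichZagierPeriods.Zeta5Search.Denom.CatalanRayBeta

end
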